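import Mathlib
import Summits.NavierStokesRegularity.NavierStokesRegularity.Theorems.EulerZoomLiouvillePowerGaugeEulerLiouvilleFadingTamePast
import HarnessLib

/-!
# Crux E `PowerGaugeEulerLiouville` (stmt-NavierStokesRegularity-19832): classical members with an exponentially fading past whose gradient decays
# at ANY ALGEBRAIC RATE in the breathing variable are trivial (MILD breathers — a widening of the LEAD's T2b stratum `…FadingTamePast`)

Route `EulerZoomLiouville` (NavierStokesRegularity), crux E; width seat ns-ezl-w4 g2, line `logtime-breathers` (residue T3, wild breathers).  The interim
LEAD's physical form of T2b (`FadingPast.curl_eq_zero`, `FadingPast.ae_eq_zero_of_gauge_of_fadingTamePast`) asks for `‖u(t, y)‖ ≤ M e^{ct}` and the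
TAME gradient `‖∇u(t, y)‖ ≤ C (1 + e^{−ct}‖y‖)^{−(1+ε)}`.  Its Lagrangian mechanism needs much less of the gradient: off the (closed, null) trapped set a
fluid particle stays at distance `≥ δ > 0` from the origin in its whole past, where ANY algebraic decay `‖∇u(t, y)‖ ≤ C (1 + e^{−ct}‖y‖)^{−q}`, `q > 0`,
already gives the INTEGRABLE stretching rate `C δ^{−q} e^{qct}` and the vanishing source `‖ω‖ ≤ 4‖∇u‖ → 0`; the Cauchy formula kills the vorticity.  So:

* `FadingPast.curl_eq_zero_of_escape_of_expRate` — the abstract kill along an escaped trajectory: slices Lipschitz, and `‖∇u(s, y)‖ ≤ D e^{ks}` for `‖y‖ ≥ δ`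
  (`k > 0`) ⇒ `ω(r₁, x₁) = 0` whenever the particle at `(r₁, x₁)` had `‖φ(r, r₁, x₁)‖ ≥ δ` for all `r ≤ r₁`;
* `FadingPast.norm_fderiv_le_const_rpow`, `FadingPast.lipschitz_and_isUniformlyLipschitzOn_rpow`, `FadingPast.curl_eq_zero_of_escape_rpow`,
  `FadingPast.curl_eq_zero_of_not_mem_trapped_rpow`, `FadingPast.curl_eq_zero_rpow` — the chain of `…FadingTamePast` with exponent `−q`, `q > 0`;
* `FadingPast.ae_eq_zero_of_gauge_of_fadingMildPast` — MEMBER LEVEL: crux hypotheses verbatim (`0 < ρ ≤ ½`) + classical on `(−∞, T₁)` (`T₁ ≤ 0`) +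
  `‖u‖ ≤ M e^{ct}` + `‖∇u(t,y)‖ ≤ C(1 + e^{−ct}‖y‖)^{−q}` (`c, q > 0`) ⇒ `u = 0` a.e.; `q = 1 + ε` is the LEAD's theorem;
* `LogtimeBreather.ae_eq_zero_of_gauge_of_mildBreather` — the MILD LOG-TIME BREATHERS: `u(τ, y) = e^{cτ} V(e^{−cτ} y)` (`τ < 0`, `c > 0`) with a bounded
  profile whose gradient decays at some algebraic rate, `‖V‖ ≤ B`, `‖∇V(z)‖ ≤ C(1+‖z‖)^{−q}`, `q > 0`, are trivial — strictly wider than T2b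
  (`q > 1`, `B` automatic) and not contained in the steep-vorticity stratum (`…LogtimeBreatherSteepVorticity` needs `kc > sup‖∇V‖`).

The trapped set, its nullity (`FadingPast.volume_trapped_eq_zero`), the finite backward displacement (`FadingPast.norm_evolutionMap_sub_le`) and the pathwise
Cauchy–Grönwall tools (`FadingPast.norm_curl_le_exp_integral_path`, `FadingPast.curl_eq_zero_of_curl_eq_zero_earlier`) are the LEAD's, imported unchanged.

WHAT THIS IS NOT: not NS regularity, not the crux E — a widening of one classical stratum of the crux CLASS 19832 on the MODEL lattice, `--supports`
stmt-19832; breathers with unbounded profile or non-decaying gradient stay in the residue T3. [folklore; MajdaBertozziCUP2002 §2.5 (2.115)–(2.117), §4.2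
(4.46)–(4.47); line card `Cruxes/PowerGaugeEulerLiouville/Lines/logtime-breathers.md` T2b/T3]
-/

noncomputable section

set_option linter.dupNamespace false

open MeasureTheory Set Filter Topology Metric Function
open scoped NNReal ENNReal ContDiff

namespace Summit.NavierStokesRegularity.NavierStokesRegularity.Theorems.PowerGaugeEulerLiouville

open Literature.Analysis Literature.Analysis.FluidPDE

namespace FadingPast

variable {u : ℝ → EuclideanSpace ℝ (Fin 3) → EuclideanSpace ℝ (Fin 3)} {p : ℝ → EuclideanSpace ℝ (Fin 3) → ℝ}
  {T₁ c M C q : ℝ}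

/-! ### The abstract kill along an escaped trajectory -/

/-- **KILL ALONG AN ESCAPED TRAJECTORY, abstract rate.**  Classical Euler on `(−∞, T₁)` with `K`-Lipschitz slices; suppose the gradient decays
EXPONENTIALLY IN TIME OFF A BALL: `‖∇u(s, y)‖ ≤ D e^{ks}` for `s < T₁`, `‖y‖ ≥ δ` (`k > 0`, `D ≥ 0`).  If the fluid particle sitting at `x₁` at time
`r₁ < T₁` had `‖φ(r, r₁, x₁)‖ ≥ δ` for all `r ≤ r₁`, then `ω(r₁, x₁) = 0`: the Cauchy formula from `σ` to `r₁` with the pathwise Grönwall factor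
`exp(D k⁻¹ e^{k r₁})` and the source `‖ω(σ, ·)‖ ≤ 4 D e^{kσ} → 0` (`σ → −∞`). [folklore; MajdaBertozziCUP2002 §2.5 (2.117), §4.2 (4.47)] -/
theorem curl_eq_zero_of_escape_of_expRate (hcl : IsClassicalEulerSolutionOn (Iio T₁) 0 u p)
    {K : ℝ≥0} (hK : ∀ s : ℝ, s < T₁ → LipschitzWith K (u s)) (hL : ODE.IsUniformlyLipschitzOn u (Iio T₁))
    {k D δ : ℝ} (hk : 0 < k) (hD : 0 ≤ D)
    (htame : ∀ s : ℝ, s < T₁ → ∀ y : EuclideanSpace ℝ (Fin 3), δ ≤ ‖y‖ → ‖fderiv ℝ (u s) y‖ ≤ D * Real.exp (k * s))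
    {r₁ : ℝ} (hr₁ : r₁ < T₁) (x₁ : EuclideanSpace ℝ (Fin 3))
    (hfar : ∀ r : ℝ, r ≤ r₁ → δ ≤ ‖ODE.evolutionMap u r₁ r x₁‖) :
    curl (u r₁) x₁ = 0 := by
  -- adapted from `FadingPast.curl_eq_zero_of_escape` (…FadingTamePastTools), with the rate abstracted
  have hS : Convex ℝ (Iio T₁) := convex_Iio _
  set A : ℝ := Real.exp (D * k⁻¹ * Real.exp (k * r₁)) * (4 * D) with hA
  have hbound : ∀ σ : ℝ, σ < r₁ → ‖curl (u r₁) x₁‖ ≤ A * Real.exp (k * σ) := by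
    intro σ hσ
    have hσT : σ < T₁ := hσ.trans hr₁
    have hpath : ∀ s ∈ uIcc σ r₁,
        ‖fderiv ℝ (u s) (ODE.evolutionMap u σ s (ODE.evolutionMap u r₁ σ x₁))‖ ≤ D * Real.exp (k * s) := by
      intro s hs
      rw [uIcc_of_le hσ.le] at hs
      have hsT : s < T₁ := lt_of_le_of_lt hs.2 hr₁
      rw [hL.evolutionMap_trans hS hr₁ hσT hsT]
      exact htame s hsT _ (hfar s hs.2)
    have h1 := norm_curl_le_exp_integral_path hcl hK hL hσT hr₁ x₁ (M := fun s => D * Real.exp (k * s))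
      (by fun_prop) hpath
    have hsrc : ‖curl (u σ) (ODE.evolutionMap u r₁ σ x₁)‖ ≤ 4 * (D * Real.exp (k * σ)) :=
      (norm_curl_le_four_mul _ _).trans
        (mul_le_mul_of_nonneg_left (htame σ hσT _ (hfar σ hσ.le)) (by norm_num))
    have hint : ∫ s in σ..r₁, D * Real.exp (k * s) = D * (k⁻¹ * (Real.exp (k * r₁) - Real.exp (k * σ))) := by
      rw [intervalIntegral.integral_const_mul, intervalIntegral.integral_comp_mul_left _ hk.ne', integral_exp,
        smul_eq_mul]
    have hint_le : |∫ s in σ..r₁, D * Real.exp (k * s)| ≤ D * k⁻¹ * Real.exp (k * r₁) := by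
      rw [hint]
      have hnn : 0 ≤ D * (k⁻¹ * (Real.exp (k * r₁) - Real.exp (k * σ))) := by
        refine mul_nonneg hD (mul_nonneg (inv_nonneg.2 hk.le) ?_)
        have := Real.exp_le_exp.2 (show k * σ ≤ k * r₁ by nlinarith)
        linarith
      rw [abs_of_nonneg hnn]
      nlinarith [Real.exp_pos (k * σ), mul_nonneg hD (inv_nonneg.2 hk.le)]
    calc ‖curl (u r₁) x₁‖
        ≤ Real.exp |∫ s in σ..r₁, D * Real.exp (k * s)| * ‖curl (u σ) (ODE.evolutionMap u r₁ σ x₁)‖ := h1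
      _ ≤ Real.exp (D * k⁻¹ * Real.exp (k * r₁)) * (4 * (D * Real.exp (k * σ))) := by gcongr
      _ = A * Real.exp (k * σ) := by rw [hA]; ring
  have hlim : Tendsto (fun σ : ℝ => A * Real.exp (k * σ)) atBot (𝓝 0) := by
    have h1 : Tendsto (fun σ : ℝ => k * σ) atBot atBot := tendsto_id.const_mul_atBot hk
    have h2 := (Real.tendsto_exp_atBot.comp h1).const_mul A
    simpa using h2
  rw [← norm_le_zero_iff]
  exact ge_of_tendsto hlim ((eventually_lt_atBot r₁).mono fun σ hσ => hbound σ hσ)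

/-! ### The chain with an algebraic rate `q > 0` -/

/-- The gradient bound `C (1 + w)^{−q}` with `w ≥ 0`, `q > 0` is at most `C`; in particular `C ≥ 0`. [folklore] -/
theorem norm_fderiv_le_const_rpow (hq : 0 < q)
    (hgrad : ∀ s : ℝ, s < T₁ → ∀ y, ‖fderiv ℝ (u s) y‖ ≤ C * (1 + Real.exp (-(c * s)) * ‖y‖) ^ (-q))
    {s : ℝ} (hs : s < T₁) (y : EuclideanSpace ℝ (Fin 3)) : ‖fderiv ℝ (u s) y‖ ≤ C := by
  have hC0 : 0 ≤ C := by
    have h := hgrad s hs 0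
    rw [norm_zero, mul_zero, add_zero, Real.one_rpow, mul_one] at h
    exact (norm_nonneg _).trans h
  refine (hgrad s hs y).trans ?_
  have h1 : (1 + Real.exp (-(c * s)) * ‖y‖) ^ (-q) ≤ 1 :=
    Real.rpow_le_one_of_one_le_of_nonpos (by nlinarith [Real.exp_pos (-(c * s)), norm_nonneg y]) (by linarith)
  nlinarith

/-- The slices are `C`-Lipschitz and the Cauchy–Lipschitz hypotheses hold on `(−∞, T₁)` (rate `q > 0`). [folklore] -/
theorem lipschitz_and_isUniformlyLipschitzOn_rpow (hcl : IsClassicalEulerSolutionOn (Iio T₁) 0 u p) (hq : 0 < q)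
    (hgrad : ∀ s : ℝ, s < T₁ → ∀ y, ‖fderiv ℝ (u s) y‖ ≤ C * (1 + Real.exp (-(c * s)) * ‖y‖) ^ (-q)) :
    ∃ K : ℝ≥0, (∀ s : ℝ, s < T₁ → LipschitzWith K (u s)) ∧ ODE.IsUniformlyLipschitzOn u (Iio T₁) := by
  have hC0 : 0 ≤ C := by
    obtain ⟨s, hs⟩ := exists_lt T₁
    exact (norm_nonneg _).trans (norm_fderiv_le_const_rpow hq hgrad hs 0)
  refine ⟨⟨C, hC0⟩, fun s hs => ?_, ?_⟩
  · refine lipschitzWith_of_nnnorm_fderiv_le ((hcl.contDiff_velocity hs).differentiable (by simp)) fun y => ?_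
    have h : (‖fderiv ℝ (u s) y‖₊ : ℝ) ≤ C := by rw [coe_nnnorm]; exact norm_fderiv_le_const_rpow hq hgrad hs y
    exact_mod_cast h
  · exact hcl.smooth_velocity.isUniformlyLipschitzOn_of_norm_fderiv_le fun K _ hKS =>
      ⟨C, fun s hs y => norm_fderiv_le_const_rpow hq hgrad (hKS hs) y⟩

/-- **KILL ALONG AN ESCAPED TRAJECTORY, algebraic rate `q > 0`**: at distance `≥ δ` from the origin the mild bound gives
`‖∇u(s, y)‖ ≤ C δ^{−q} e^{qcs}`, and `curl_eq_zero_of_escape_of_expRate` applies with `k = qc`. [folklore] -/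
theorem curl_eq_zero_of_escape_rpow (hcl : IsClassicalEulerSolutionOn (Iio T₁) 0 u p) (hc : 0 < c) (hq : 0 < q)
    (hgrad : ∀ s : ℝ, s < T₁ → ∀ y, ‖fderiv ℝ (u s) y‖ ≤ C * (1 + Real.exp (-(c * s)) * ‖y‖) ^ (-q))
    {r₁ : ℝ} (hr₁ : r₁ < T₁) (x₁ : EuclideanSpace ℝ (Fin 3)) {δ : ℝ} (hδ : 0 < δ)
    (hfar : ∀ r : ℝ, r ≤ r₁ → δ ≤ ‖ODE.evolutionMap u r₁ r x₁‖) :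
    curl (u r₁) x₁ = 0 := by
  obtain ⟨K, hK, hL⟩ := lipschitz_and_isUniformlyLipschitzOn_rpow hcl hq hgrad
  have hC0 : 0 ≤ C := (norm_nonneg _).trans (norm_fderiv_le_const_rpow hq hgrad hr₁ 0)
  set k : ℝ := q * c with hk
  have hk0 : 0 < k := by positivity
  set D : ℝ := C * δ ^ (-q) with hD
  have hD0 : 0 ≤ D := mul_nonneg hC0 (Real.rpow_nonneg hδ.le _)
  have htame : ∀ s : ℝ, s < T₁ → ∀ y : EuclideanSpace ℝ (Fin 3), δ ≤ ‖y‖ →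
      ‖fderiv ℝ (u s) y‖ ≤ D * Real.exp (k * s) := by
    intro s hs y hy
    refine (hgrad s hs y).trans ?_
    have hE : 0 < Real.exp (-(c * s)) := Real.exp_pos _
    have hbase : Real.exp (-(c * s)) * δ ≤ 1 + Real.exp (-(c * s)) * ‖y‖ := by nlinarith
    have h1 : (1 + Real.exp (-(c * s)) * ‖y‖) ^ (-q) ≤ (Real.exp (-(c * s)) * δ) ^ (-q) :=
      Real.rpow_le_rpow_of_nonpos (by positivity) hbase (by linarith)
    have h2 : (Real.exp (-(c * s)) * δ) ^ (-q) = δ ^ (-q) * Real.exp (k * s) := by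
      rw [Real.mul_rpow hE.le hδ.le, ← Real.exp_mul, mul_comm]
      congr 2
      rw [hk]; ring
    rw [hD, mul_assoc]
    exact mul_le_mul_of_nonneg_left (h1.trans h2.le) hC0
  exact curl_eq_zero_of_escape_of_expRate hcl hK hL hk0 hD0 htame hr₁ x₁ hfar

/-- **OFF THE TRAPPED SET THE VORTICITY VANISHES** (rate `q > 0`): escape at some `r₁ ≤ τ`, finite displacement before `r₁`
(`norm_evolutionMap_sub_le`), `curl_eq_zero_of_escape_rpow`, transport of the zero to `τ`. [folklore] -/
theorem curl_eq_zero_of_not_mem_trapped_rpow (hcl : IsClassicalEulerSolutionOn (Iio T₁) 0 u p) (hc : 0 < c) (hq : 0 < q)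
    (hvel : ∀ s : ℝ, s < T₁ → ∀ y, ‖u s y‖ ≤ M * Real.exp (c * s))
    (hgrad : ∀ s : ℝ, s < T₁ → ∀ y, ‖fderiv ℝ (u s) y‖ ≤ C * (1 + Real.exp (-(c * s)) * ‖y‖) ^ (-q))
    {τ : ℝ} (hτ : τ < T₁) {x : EuclideanSpace ℝ (Fin 3)}
    (hx : x ∉ {x : EuclideanSpace ℝ (Fin 3) | ∀ r : ℝ, r ≤ τ → ‖ODE.evolutionMap u τ r x‖ ≤ M / c * Real.exp (c * r)}) :
    curl (u τ) x = 0 := by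
  obtain ⟨K, hK, hL⟩ := lipschitz_and_isUniformlyLipschitzOn_rpow hcl hq hgrad
  simp only [mem_setOf_eq, not_forall, not_le, exists_prop] at hx
  obtain ⟨r₁, hr₁, hbig⟩ := hx
  have hr₁T : r₁ < T₁ := lt_of_le_of_lt hr₁ hτ
  set x₁ := ODE.evolutionMap u τ r₁ x with hx₁
  set δ : ℝ := ‖x₁‖ - M / c * Real.exp (c * r₁) with hδ
  have hδ0 : 0 < δ := by rw [hδ]; linarith
  have hfar : ∀ r : ℝ, r ≤ r₁ → δ ≤ ‖ODE.evolutionMap u r₁ r x₁‖ := by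
    intro r hr
    have h1 := norm_evolutionMap_sub_le hL hc hvel hr₁T hr x₁
    have h2 := norm_sub_norm_le x₁ (ODE.evolutionMap u r₁ r x₁)
    rw [← norm_neg, neg_sub] at h1
    rw [hδ]; linarith
  have hzero : curl (u r₁) x₁ = 0 := curl_eq_zero_of_escape_rpow hcl hc hq hgrad hr₁T x₁ hδ0 hfar
  exact curl_eq_zero_of_curl_eq_zero_earlier hcl hK hr₁T hτ x hzero

/-- **A CLASSICAL EULER FLOW WITH AN EXPONENTIALLY FADING, MILDLY TAME PAST IS IRROTATIONAL**: `‖u(t,y)‖ ≤ M e^{ct}`,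
`‖∇u(t,y)‖ ≤ C(1 + e^{−ct}‖y‖)^{−q}` on `(−∞, T₁)` (`c, q > 0`) ⇒ `curl u(τ) ≡ 0` for every `τ < T₁` (off the closed null trapped set, hence
everywhere by continuity). [folklore; line `logtime-breathers` T2b/T3] -/
theorem curl_eq_zero_rpow (hcl : IsClassicalEulerSolutionOn (Iio T₁) 0 u p) (hc : 0 < c) (hq : 0 < q)
    (hvel : ∀ s : ℝ, s < T₁ → ∀ y, ‖u s y‖ ≤ M * Real.exp (c * s))
    (hgrad : ∀ s : ℝ, s < T₁ → ∀ y, ‖fderiv ℝ (u s) y‖ ≤ C * (1 + Real.exp (-(c * s)) * ‖y‖) ^ (-q))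
    {τ : ℝ} (hτ : τ < T₁) (x : EuclideanSpace ℝ (Fin 3)) : curl (u τ) x = 0 := by
  obtain ⟨K, -, hL⟩ := lipschitz_and_isUniformlyLipschitzOn_rpow hcl hq hgrad
  have hM : 0 ≤ M := by
    have h := hvel τ hτ 0
    exact le_of_mul_le_mul_right ((norm_nonneg _).trans h |> le_trans (by simp)) (Real.exp_pos (c * τ))
  set T : Set (EuclideanSpace ℝ (Fin 3)) :=
    {x : EuclideanSpace ℝ (Fin 3) | ∀ r : ℝ, r ≤ τ → ‖ODE.evolutionMap u τ r x‖ ≤ M / c * Real.exp (c * r)} with hT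
  have hnull : volume T = 0 := volume_trapped_eq_zero hcl hL hc hM hτ
  have hdense : Dense Tᶜ := by
    rw [← interior_eq_empty_iff_dense_compl]
    by_contra hne
    have hpos := (isOpen_interior.measure_pos volume (nonempty_iff_ne_empty.2 hne))
    have hle : volume (interior T) ≤ 0 := hnull ▸ measure_mono interior_subset
    exact absurd (lt_of_lt_of_le hpos hle) (lt_irrefl _)
  have hcont : Continuous (curl (u τ)) :=
    continuous_curl ((hcl.contDiff_velocity hτ).of_le (by exact_mod_cast le_top))
  have h := Continuous.ext_on hdense hcont continuous_const fun y hy =>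
    curl_eq_zero_of_not_mem_trapped_rpow hcl hc hq hvel hgrad hτ hy
  exact congrFun h x

/-! ### Member level -/

/-- **MEMBERS WITH AN EXPONENTIALLY FADING, MILDLY TAME PAST ARE TRIVIAL.**  Crux hypotheses verbatim (`0 < ρ ≤ ½`) + `(u, p)` classical on a past
sub-slab `(−∞, T₁)`, `T₁ ≤ 0`, with `‖u(t,y)‖ ≤ M e^{ct}` and `‖∇u(t,y)‖ ≤ C(1 + e^{−ct}‖y‖)^{−q}` there (`c, q > 0`; nothing assumed on `[T₁, 0)`) ⇒ `u = 0`
a.e. on `(−∞, 0) × ℝ³` (`curl_eq_zero_rpow` + the tree's `PastIrrotational.ae_eq_zero_of_gauge_of_pastIrrotational`).  `q = 1 + ε` is the LEAD's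
`FadingPast.ae_eq_zero_of_gauge_of_fadingTamePast`. [folklore; line card `Lines/logtime-breathers.md` T2b] -/
theorem ae_eq_zero_of_gauge_of_fadingMildPast {ρ : ℝ} (hρ : 0 < ρ) (hρh : ρ ≤ 1 / 2)
    {H : ℝ → EuclideanSpace ℝ (Fin 3) → EuclideanSpace ℝ (Fin 3) →L[ℝ] EuclideanSpace ℝ (Fin 3)} {c₀ : ℝ≥0}
    (hsw : IsSuitableWeakSolutionOn (slab (EuclideanSpace ℝ (Fin 3)) (Iio 0) isOpen_Iio) 0 0 u p)
    (hH : HasWeakSpatialGradientOn (slab (EuclideanSpace ℝ (Fin 3)) (Iio 0) isOpen_Iio) u H)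
    (hgauge : ∀ a : ℝ, 0 < a →
      ENNReal.ofReal (a ^ (2 * ρ)) * cknA a (0 : ℝ × EuclideanSpace ℝ (Fin 3)) u +
          ENNReal.ofReal (a ^ ρ) * cknE a (0 : ℝ × EuclideanSpace ℝ (Fin 3)) H +
        ENNReal.ofReal (a ^ (2 * ρ)) * cknD a (0 : ℝ × EuclideanSpace ℝ (Fin 3)) p ≤ (c₀ : ℝ≥0∞))
    (hT₁ : T₁ ≤ 0) (hcl : IsClassicalEulerSolutionOn (Iio T₁) 0 u p) (hc : 0 < c) (hq : 0 < q)
    (hvel : ∀ s : ℝ, s < T₁ → ∀ y, ‖u s y‖ ≤ M * Real.exp (c * s))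
    (hgrad : ∀ s : ℝ, s < T₁ → ∀ y, ‖fderiv ℝ (u s) y‖ ≤ C * (1 + Real.exp (-(c * s)) * ‖y‖) ^ (-q)) :
    uncurry u =ᵐ[volume.restrict (Iio (0 : ℝ) ×ˢ (univ : Set (EuclideanSpace ℝ (Fin 3))))] 0 :=
  PastIrrotational.ae_eq_zero_of_gauge_of_pastIrrotational hρ hρh hsw hH hgauge hT₁
    (fun τ hτ => (hcl.contDiff_velocity hτ).of_le (by norm_cast))
    (fun τ hτ => hcl.divFree τ hτ) (fun τ hτ x => curl_eq_zero_rpow hcl hc hq hvel hgrad hτ x)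

end FadingPast

namespace LogtimeBreather

variable {u : ℝ → EuclideanSpace ℝ (Fin 3) → EuclideanSpace ℝ (Fin 3)} {p : ℝ → EuclideanSpace ℝ (Fin 3) → ℝ}

/-- **MILD LOG-TIME BREATHERS ARE TRIVIAL** (line `logtime-breathers`, inside residue T3; binders = the line's `IsLogtimeBreather u c V` unfolded, plus the
mild-profile hypotheses).  Crux hypotheses verbatim (`0 < ρ ≤ ½`) + `(u, p)` classical on the past + `u(τ, y) = e^{cτ} V(e^{−cτ} y)` for all `τ < 0` with
`c > 0` + `‖V(z)‖ ≤ B` + `‖∇V(z)‖ ≤ C(1 + ‖z‖)^{−q}` with `q > 0` ⇒ `u = 0` a.e. on `(−∞, 0) × ℝ³`: `‖u(τ,y)‖ ≤ B e^{cτ}`, `∇u(τ, y) = ∇V(e^{−cτ}y)`, and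
`FadingPast.ae_eq_zero_of_gauge_of_fadingMildPast` applies with `T₁ = 0`.  For `q > 1` the bound on `V` is automatic and this is T2b
(`ae_eq_zero_of_gauge_of_tameBreather`). [folklore; line card `Lines/logtime-breathers.md` T2b/T3] -/
theorem ae_eq_zero_of_gauge_of_mildBreather {ρ : ℝ} (hρ : 0 < ρ) (hρh : ρ ≤ 1 / 2)
    {H : ℝ → EuclideanSpace ℝ (Fin 3) → EuclideanSpace ℝ (Fin 3) →L[ℝ] EuclideanSpace ℝ (Fin 3)} {c₀ : ℝ≥0}
    (hsw : IsSuitableWeakSolutionOn (slab (EuclideanSpace ℝ (Fin 3)) (Iio 0) isOpen_Iio) 0 0 u p)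
    (hH : HasWeakSpatialGradientOn (slab (EuclideanSpace ℝ (Fin 3)) (Iio 0) isOpen_Iio) u H)
    (hgauge : ∀ a : ℝ, 0 < a →
      ENNReal.ofReal (a ^ (2 * ρ)) * cknA a (0 : ℝ × EuclideanSpace ℝ (Fin 3)) u +
          ENNReal.ofReal (a ^ ρ) * cknE a (0 : ℝ × EuclideanSpace ℝ (Fin 3)) H +
        ENNReal.ofReal (a ^ (2 * ρ)) * cknD a (0 : ℝ × EuclideanSpace ℝ (Fin 3)) p ≤ (c₀ : ℝ≥0∞))
    (hcl : IsClassicalEulerSolutionOn (Iio 0) 0 u p) {c : ℝ} {V : EuclideanSpace ℝ (Fin 3) → EuclideanSpace ℝ (Fin 3)}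
    (hc : 0 < c) (hbr : c ≠ 0 ∧ ∀ τ : ℝ, τ < 0 → ∀ y, u τ y = Real.exp (c * τ) • V (Real.exp (-(c * τ)) • y))
    {B C q : ℝ} (hVb : ∀ z, ‖V z‖ ≤ B) (hq : 0 < q) (hVgrad : ∀ z, ‖fderiv ℝ V z‖ ≤ C * (1 + ‖z‖) ^ (-q)) :
    uncurry u =ᵐ[volume.restrict (Iio (0 : ℝ) ×ˢ (univ : Set (EuclideanSpace ℝ (Fin 3))))] 0 := by
  -- adapted from …LogtimeBreatherSteepVorticity (`LogtimeBreather.ae_eq_zero_of_gauge_of_steepVorticityBreather`)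
  obtain ⟨-, hbr⟩ := hbr
  have hVrep : V = fun z => Real.exp c • u (-1) (Real.exp (-c) • z) := by
    funext z
    have h := hbr (-1) (by norm_num) (Real.exp (-c) • z)
    rw [mul_neg_one, neg_neg, smul_smul, ← Real.exp_add, add_neg_cancel, Real.exp_zero, one_smul] at h
    rw [h, smul_smul, ← Real.exp_add, add_neg_cancel, Real.exp_zero, one_smul]
  have hV : ContDiff ℝ 1 V := by
    rw [hVrep]
    have h1 : ContDiff ℝ 1 (u (-1)) := (hcl.contDiff_velocity (by norm_num : (-1 : ℝ) < 0)).of_le (by exact_mod_cast le_top)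
    exact (h1.comp (contDiff_const_smul _)).const_smul _
  have hVd : Differentiable ℝ V := hV.differentiable one_ne_zero
  -- (H1) exponentially fading velocity
  have hvel : ∀ s : ℝ, s < 0 → ∀ y, ‖u s y‖ ≤ B * Real.exp (c * s) := by
    intro s hs y
    rw [hbr s hs y, norm_smul, Real.norm_eq_abs, abs_of_pos (Real.exp_pos _), mul_comm]
    exact mul_le_mul_of_nonneg_right (hVb _) (Real.exp_pos _).le
  -- the gradient in the breathing variable: `∇u(s, y) = ∇V(e^{-cs} y)`
  have hder : ∀ s : ℝ, s < 0 → ∀ y, fderiv ℝ (u s) y = fderiv ℝ V (Real.exp (-(c * s)) • y) := by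
    intro s hs y
    have hus : u s = fun y => Real.exp (c * s) • V (Real.exp (-(c * s)) • y) := funext (hbr s hs)
    have h : HasFDerivAt (u s) (fderiv ℝ V (Real.exp (-(c * s)) • y)) y := by
      rw [hus]
      have h1 : HasFDerivAt (fun y : EuclideanSpace ℝ (Fin 3) => Real.exp (-(c * s)) • y)
          (Real.exp (-(c * s)) • ContinuousLinearMap.id ℝ (EuclideanSpace ℝ (Fin 3))) y :=
        (ContinuousLinearMap.id ℝ (EuclideanSpace ℝ (Fin 3))).hasFDerivAt.const_smul (Real.exp (-(c * s)))
      have h2 := ((hVd (Real.exp (-(c * s)) • y)).hasFDerivAt.comp y h1).const_smul (Real.exp (c * s))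
      refine h2.congr_fderiv ?_
      ext v
      simp only [FunLike.coe_smul, Pi.smul_apply, ContinuousLinearMap.comp_apply, ContinuousLinearMap.id_apply,
        map_smul, smul_smul, ← Real.exp_add, add_neg_cancel, Real.exp_zero, one_smul]
    exact h.fderiv
  -- (H2) the mild gradient in physical variables
  have hgrad : ∀ s : ℝ, s < 0 → ∀ y, ‖fderiv ℝ (u s) y‖ ≤ C * (1 + Real.exp (-(c * s)) * ‖y‖) ^ (-q) := by
    intro s hs y
    rw [hder s hs y]
    have h := hVgrad (Real.exp (-(c * s)) • y)
    rwa [norm_smul, Real.norm_eq_abs, abs_of_pos (Real.exp_pos _)] at h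
  exact FadingPast.ae_eq_zero_of_gauge_of_fadingMildPast hρ hρh hsw hH hgauge le_rfl hcl hc hq hvel hgrad

end LogtimeBreather

end Summit.NavierStokesRegularity.NavierStokesRegularity.Theorems.PowerGaugeEulerLiouville

end
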